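import Literature.NumberTheory.EllipticCurves.HasseWeilGoodReductionFrobeniusProofs
import Literature.NumberTheory.EllipticCurves.ReductionInertiaInvarianceProofs
import HarnessLib

/-!
# Residue maps at a prime of `\bar 𝓞_v`: the local Frobenius is the `q`-th power on the residue
# field of `𝒪_w`, its fixed points come from `k_v`, and `\bar ℤ_K/𝔓_{ι,𝔐}`, `k_v` embed in it

Proof file (theorems only) in the local rendering of `SelmerFiniteProofs` /
`HasseWeilGoodReductionFrobeniusProofs` (the completion `K_v`, `K̄_v` with its spectral valuation
`w`, the prime `𝔐` of the local absolute integers `\bar 𝓞_v = 𝒪_w`, a local Frobenius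
`σ ∈ Γ_{K_v}` at `𝔐`, `exists_isArithFrobAt_localAbsIntegers`), supplying the residue-field
bookkeeping for the torsion-point forms of Serre–Tate's Lemma 2 at the multiplicative places
(`HasseWeilAbelianEulerFactorTorsionProofs`, whose reduction data are valued in any domain `k'`
receiving `\bar ℤ_K/𝔓` injectively — here `k' = k(𝒪_w)`, the residue field of the valuation ring
of `w`, the natural target of `WeierstrassCurve.reducePoint`):

* `Literature.NumberTheory.EllipticCurves.mem_range_of_pow_card_eq`: in a field `k`, the fixed
  points of `u ↦ u^q` are the image of any finite field of `q` elements mapping to `k`;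
* `residue_smul_eq_pow_residueCard_of_isArithFrobAt`: **the local Frobenius acts on `k(𝒪_w)` as
  the `N v`-th power**, `\overline{σ z} = z̄^{N v}` (`IsArithFrobAt` on `\bar 𝓞_v = 𝒪_w`,
  `𝔐 = {w < 1}`);
* `exists_residueFieldMap_adicCompletionIntegers`: the embedding `j : k_v → k(𝒪_w)` with
  `j(ā) = ā`, injective, whose image contains every fixed point of the `N v`-th power map (the
  hypotheses `hgj`, `hfix` of `SplitNodeQuadraticProofs`);
* `exists_ringHom_quotient_primeBelow`: the injective residue map
  `φ : \bar ℤ_K/𝔓_{ι,𝔐} → k(𝒪_w)`, `φ(b̄) = \overline{ι b}`, along a `K`-embedding `ι : K̄ → K̄_v`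
  (the `φ` of `HasseWeilAbelianEulerFactorTorsionProofs`).

## References

* J. Neukirch, *Algebraic Number Theory* (1999), Ch. II (4.8), (6.2), (8.1), §9 (9.9) (residue
  field extension of `K̄_v/K_v` and its Frobenius). [NeukirchANT1999]
* J.-P. Serre, *Local Fields*, GTM 67, Ch. I §7–§8.

## Design

Theorems only; the maps are produced existentially with their defining properties (they are
`IsLocalRing.ResidueField.map` of the local homomorphism `𝓞_v → 𝒪_w`, resp. the factorisation of
`residue ∘ ι` through `\bar ℤ_K/𝔓_{ι,𝔐}`); the spectral valuation enters through `hw` as in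
`SelmerFiniteProofs`.
-/

noncomputable section

open scoped NNReal NumberField Polynomial
open NumberField IsDedekindDomain Field Polynomial

universe u

/-! ### A finite field inside a field: the roots of `T^q - T` -/

namespace Literature.NumberTheory.EllipticCurves

/-- **The image of a finite field `F` of `q` elements in a field `k` is the set of roots of
`T^q - T`**: an element `u ∈ k` with `u^q = u` lies in the image of `j : F → k` (the `q` images
are roots, and there are at most `q` roots).  Applied to the Frobenius `t ↦ t^q` of `k ⊇ k_v`:
its fixed field is `k_v`. [folklore] -/
theorem mem_range_of_pow_card_eq {F : Type*} [Field F] [Fintype F] {k : Type*} [Field k]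
    (j : F →+* k) {u : k} (hu : u ^ Fintype.card F = u) : u ∈ j.range := by
  classical
  set q := Fintype.card F with hq
  have hq1 : 1 < q := Fintype.one_lt_card
  set f : k[X] := X ^ q - X with hf
  have hf0 : f ≠ 0 := FiniteField.X_pow_card_sub_X_ne_zero k hq1
  have hdeg : f.natDegree = q := FiniteField.X_pow_card_sub_X_natDegree_eq k hq1
  -- the images of the elements of `F` are roots
  set S : Finset k := Finset.univ.image j with hS
  have hScard : S.card = q := by
    rw [hS, Finset.card_image_of_injective _ j.injective, Finset.card_univ]
  have hSsub : S ⊆ f.roots.toFinset := by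
    intro y hy
    rw [hS, Finset.mem_image] at hy
    obtain ⟨t, -, rfl⟩ := hy
    rw [Multiset.mem_toFinset, mem_roots hf0, IsRoot.def, hf, eval_sub, eval_pow, eval_X,
      ← map_pow, FiniteField.pow_card, sub_self]
  have hcard : f.roots.toFinset.card ≤ S.card := by
    rw [hScard, ← hdeg]
    exact (Multiset.toFinset_card_le _).trans (card_roots' f)
  have hST := Finset.eq_of_subset_of_card_le hSsub hcard
  have huT : u ∈ f.roots.toFinset := by
    rw [Multiset.mem_toFinset, mem_roots hf0, IsRoot.def, hf, eval_sub, eval_pow, eval_X, hu,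
      sub_self]
  rw [← hST, hS, Finset.mem_image] at huT
  obtain ⟨t, -, ht⟩ := huT
  exact ⟨t, ht⟩

end Literature.NumberTheory.EllipticCurves

namespace IsDedekindDomain.HeightOneSpectrum

open Literature.NumberTheory.EllipticCurves Literature.NumberTheory.GaloisRepresentations

variable {K : Type u} [Field K] [NumberField K] (v : HeightOneSpectrum (𝓞 K))
  {w : Valuation (AlgebraicClosure (v.adicCompletion K)) ℝ≥0}
  (hw : ∀ x, (w x : ℝ) = spectralNorm (v.adicCompletion K) (AlgebraicClosure (v.adicCompletion K)) x)

include hw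

/-- **The local Frobenius is the `q_v`-th power on the residue field of `𝒪_w`.**  For an
arithmetic Frobenius `σ ∈ Γ_{K_v}` at the prime `𝔐` of `\bar 𝓞_v` above `𝓂_v`
(`σ b ≡ b^{q_v} mod 𝔐`, Mathlib `IsArithFrobAt`; `exists_isArithFrobAt_localAbsIntegers`) and a
`w`-integer `z`: `\overline{σ z} = z̄ ^ {N v}` in the residue field of `𝒪_w = \bar 𝓞_v`
(`𝔐 = {w < 1}`, `mem_iff_spectralValuation_lt_one`).  Neukirch, *ANT*, II (9.9) (the map
`G → G(λ|κ)`). [folklore] -/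
theorem residue_smul_eq_pow_residueCard_of_isArithFrobAt {𝔐 : Ideal v.localAbsIntegers}
    (h𝔐 : 𝔐 ∈ v.localPrimesAbove) {σ : absoluteGaloisGroup (v.adicCompletion K)}
    (hσ : IsArithFrobAt (v.adicCompletionIntegers K) σ 𝔐) (z : w.integer)
    (hσz : w (σ • (z : AlgebraicClosure (v.adicCompletion K))) ≤ 1) :
    IsLocalRing.residue w.integer ⟨σ • (z : AlgebraicClosure (v.adicCompletion K)), hσz⟩ =
      IsLocalRing.residue w.integer z ^ v.residueCard := by
  set L := AlgebraicClosure (v.adicCompletion K)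
  have hzb : (z : L) ∈ v.localAbsIntegers := (mem_localAbsIntegers_iff_spectralValuation hw).mpr z.2
  set b : v.localAbsIntegers := ⟨z, hzb⟩ with hb
  have hq : Nat.card (v.adicCompletionIntegers K ⧸ 𝔐.under (v.adicCompletionIntegers K)) =
      v.residueCard := by
    rw [natCard_quotient_under_eq_of_mem_localPrimesAbove v h𝔐,
      WeierstrassCurve.natCard_residueField_eq_residueCard]
  have hmem : σ • b - b ^ v.residueCard ∈ 𝔐 := by
    have := hσ b
    rwa [MulSemiringAction.toAlgHom_apply, hq] at this
  have hlt : w ((σ • (z : L)) - (z : L) ^ v.residueCard) < 1 := by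
    have := (mem_iff_spectralValuation_lt_one hw h𝔐).mp hmem
    simpa [hb, integralClosure.coe_smul] using this
  have hzq : w ((z : L) ^ v.residueCard) ≤ 1 := by
    rw [map_pow]; exact pow_le_one' z.2 _
  have h1 := WeierstrassCurve.residue_eq_of_val_sub_lt_one hzq hσz hlt
  rw [h1]
  have : (⟨(z : L) ^ v.residueCard, hzq⟩ : w.integer) = z ^ v.residueCard := Subtype.ext (by simp)
  rw [this, map_pow]

/-- **The residue field of `𝓞_v` inside that of `𝒪_w`.**  There is a ring homomorphism
`j : k_v → k(𝒪_w)` with `j(ā) = \overline{a}` for `a ∈ 𝓞_v ⊆ 𝒪_w` (induced by the local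
homomorphism `𝓞_v → 𝒪_w`; injective, `k_v` being a field), such that (i) the local Frobenius
fixes its image and (ii) **every fixed point of the `N v`-th power map of `k(𝒪_w)` lies in its
image** (`k_v` has `N v` elements: `FiniteField.pow_card`; `T^q - T` has at most `q` roots,
`mem_range_of_pow_card_eq`).  Neukirch, *ANT*, II (9.9): the residue extension `λ ⊇ κ` and its
Frobenius. [folklore] -/
theorem exists_residueFieldMap_adicCompletionIntegers :
    ∃ j : IsLocalRing.ResidueField (v.adicCompletionIntegers K) →+* IsLocalRing.ResidueField w.integer,
      (∀ (a : v.adicCompletionIntegers K)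
        (ha : w (algebraMap (v.adicCompletion K) (AlgebraicClosure (v.adicCompletion K))
          (algebraMap (v.adicCompletionIntegers K) (v.adicCompletion K) a)) ≤ 1),
        j (IsLocalRing.residue (v.adicCompletionIntegers K) a) = IsLocalRing.residue w.integer ⟨_, ha⟩) ∧
      Function.Injective j ∧
      ∀ u : IsLocalRing.ResidueField w.integer, u ^ v.residueCard = u → u ∈ j.range := by
  set L := AlgebraicClosure (v.adicCompletion K)
  set O := v.adicCompletionIntegers K
  have hv0 : w.Integers w.integer := Valuation.integer.integers w
  have hle : ∀ a : O, w (algebraMap (v.adicCompletion K) L (algebraMap O (v.adicCompletion K) a)) ≤ 1 :=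
    fun a ↦ (spectralValuation_algebraMap_le_one_iff hw _).mpr a.2
  let jO : O →+* w.integer :=
    { toFun := fun a ↦ ⟨_, hle a⟩
      map_one' := Subtype.ext (by simp)
      map_mul' := fun a b ↦ Subtype.ext (by simp)
      map_zero' := Subtype.ext (by simp)
      map_add' := fun a b ↦ Subtype.ext (by simp) }
  haveI : IsLocalHom jO := by
    refine ⟨fun a ha ↦ ?_⟩
    rw [hv0.isUnit_iff_valuation_eq_one] at ha
    change w (algebraMap (v.adicCompletion K) L (algebraMap O (v.adicCompletion K) a)) = 1 at ha
    by_contra hna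
    have hmem : a ∈ IsLocalRing.maximalIdeal O := (IsLocalRing.mem_maximalIdeal _).mpr hna
    have hlt : Valued.v (algebraMap O (v.adicCompletion K) a) < 1 :=
      (mem_maximalIdeal_adicCompletionIntegers_iff (a := a)).mp hmem
    have : w (algebraMap (v.adicCompletion K) L (algebraMap O (v.adicCompletion K) a)) < 1 := by
      rw [← NNReal.coe_lt_coe, coe_spectralValuation_algebraMap hw, NNReal.coe_one]
      exact (Valued.toNormedField.norm_lt_one_iff).mpr hlt
    exact this.ne ha
  let j : IsLocalRing.ResidueField O →+* IsLocalRing.ResidueField w.integer :=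
    IsLocalRing.ResidueField.map jO
  have hj : ∀ (a : O) (ha : w (algebraMap (v.adicCompletion K) L (algebraMap O (v.adicCompletion K) a)) ≤ 1),
      j (IsLocalRing.residue O a) = IsLocalRing.residue w.integer ⟨_, ha⟩ := by
    intro a ha
    rw [IsLocalRing.ResidueField.map_residue]
    exact congrArg _ (Subtype.ext rfl)
  refine ⟨j, hj, j.injective, fun u hu ↦ ?_⟩
  haveI : Finite (IsLocalRing.ResidueField O) := finite_residueField_adicCompletionIntegers K v
  letI : Fintype (IsLocalRing.ResidueField O) := Fintype.ofFinite _
  have hcard : Fintype.card (IsLocalRing.ResidueField O) = v.residueCard := by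
    rw [← Nat.card_eq_fintype_card, WeierstrassCurve.natCard_residueField_eq_residueCard]
  exact mem_range_of_pow_card_eq j (by rw [hcard]; exact hu)

variable (ι : AlgebraicClosure K →ₐ[K] AlgebraicClosure (v.adicCompletion K))

/-- **The residue map of `\bar ℤ_K` at the prime cut out by `ι`.**  For a `K`-embedding
`ι : K̄ → K̄_v`, the spectral valuation `w` on `K̄_v` and the prime `𝔐` of `\bar 𝓞_v` above `𝓂_v`,
there is an injective ring homomorphism `φ : \bar ℤ_K/𝔓_{ι,𝔐} → k(𝒪_w)` with
`φ(b̄) = \overline{ι b}`: `ι` maps `\bar ℤ_K` into `\bar 𝓞_v = 𝒪_w`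
(`mem_localAbsIntegers_iff_spectralValuation`), `𝔓_{ι,𝔐} = ι⁻¹(𝔐)` and `𝔐 = {w < 1}`
(`mem_iff_spectralValuation_lt_one`) is the kernel of the residue map, and
`\bar ℤ_K/𝔓_{ι,𝔐}` is a field (`isMaximal_of_mem_primesAbove`).  Neukirch, *ANT*, II (8.1): the
embedding `L ↪ L_w` and its residue fields. [folklore] -/
theorem exists_ringHom_quotient_primeBelow {𝔐 : Ideal v.localAbsIntegers}
    (h𝔐 : 𝔐 ∈ v.localPrimesAbove) :
    ∃ φ : absIntegers (𝓞 K) K ⧸ v.primeBelow ι 𝔐 →+* IsLocalRing.ResidueField w.integer,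
      Function.Injective φ ∧
      ∀ (b : absIntegers (𝓞 K) K) (hb : w (ι b) ≤ 1),
        φ (Ideal.Quotient.mk _ b) = IsLocalRing.residue w.integer ⟨ι b, hb⟩ := by
  have hv0 : w.Integers w.integer := Valuation.integer.integers w
  have hle : ∀ b : absIntegers (𝓞 K) K, w (ι b) ≤ 1 := fun b ↦
    (mem_localAbsIntegers_iff_spectralValuation hw).mp (absIntegersToLocal v ι b).2
  let φ₁ : absIntegers (𝓞 K) K →+* w.integer :=
    { toFun := fun b ↦ ⟨ι b, hle b⟩
      map_one' := Subtype.ext (by simp)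
      map_mul' := fun x y ↦ Subtype.ext (by simp)
      map_zero' := Subtype.ext (by simp)
      map_add' := fun x y ↦ Subtype.ext (by simp) }
  let φ₂ : absIntegers (𝓞 K) K →+* IsLocalRing.ResidueField w.integer :=
    (IsLocalRing.residue w.integer).comp φ₁
  have hker : ∀ b ∈ v.primeBelow ι 𝔐, φ₂ b = 0 := by
    intro b hb
    rw [mem_primeBelow_iff, mem_iff_spectralValuation_lt_one hw h𝔐,
      coe_absIntegersToLocal_apply] at hb
    change IsLocalRing.residue w.integer (φ₁ b) = 0
    rw [← v_algebraMap_lt_one_iff hv0]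
    exact hb
  haveI : (v.primeBelow ι 𝔐).IsMaximal :=
    isMaximal_of_mem_primesAbove (primeBelow_mem_primesAbove h𝔐)
  letI : Field (absIntegers (𝓞 K) K ⧸ v.primeBelow ι 𝔐) := Ideal.Quotient.field _
  refine ⟨Ideal.Quotient.lift _ φ₂ hker, RingHom.injective _, fun b hb ↦ ?_⟩
  rw [Ideal.Quotient.lift_mk]
  rfl

end IsDedekindDomain.HeightOneSpectrum

end
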